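import Summits.BirchSwinnertonDyer.BirchSwinnertonDyer.Theorems.GenusKolyvaginAtTwoCyclicTorsionOfNegDisc
import HarnessLib

/-!
# Route `ByReductionTypeAtTwo`, crux `RankOneAtTwoOffBigImageOddLocal` (stmt-BirchSwinnertonDyer-23716), line
# `refined_kolyvagin_tamagawa_shift_at_two`: the algebra behind the REGULAR witness filter at `p = 2` (helpers, PROVED)

Lead prover `prover-cruxlead-stmt-BirchSwinnertonDyer-23716-g0` (2026-08-28).  Two kernel lemmas of the registered skeleton
`Cruxes/RankOneAtTwoOffBigImageOddLocal/Lines/refined_kolyvagin_tamagawa_shift_at_two.lean` (g6), landed as `--supports` helpers of the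
crux so that the line's filtered stubs (`StringentPrimitivityModTwoWithOn Φ_reg Ω`, `ShiftedKolyvaginStructureModTwoWithOn Φ_reg Ω`, cards
`regular-frobenius-kolyvagin-primes-pos-disc` / `sharp-kolyvagin-primes-at-two`) can import them BY NAME instead of re-proving them:

* `cyclicTorsion_of_smul_twoTorsion_ne` — **R1** (card #7's `CyclicTorsionOfRegularElement`, the pen's in-Lean falsifier (a), PASSED):
  for EVERY `h ∈ Gal(ℚ̄/ℚ)` that moves some `2`-torsion point of `E` and every `M`, `E[2^M] = {a·P + b·hP}` for one `P ∈ E[2^M]` —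
  `E[2^M] ≅ ℤ/2^M[⟨h⟩]` is free of rank one.  This is item Q1 `CyclicTorsionOfNegDisc` (stmt-24879, `Δ < 0`, `h` = complex conjugation,
  `GenusCyclicTorsion.cyclicTorsionOfNegDisc_proof`) with its only use of `Δ < 0` — producing the moved `2`-torsion point — turned into
  the hypothesis; the proof is that file's induction/lift/count verbatim (its `two_dvd_of_rel_twoTorsion`, `pow_dvd_of_rel` imported BY
  NAME — the gate's `dedup.landed` forbids re-homing them, so this module knowingly sits in the theses-cone of route `GenusKolyvaginAtTwo`
  through that import —, `zsmul_geomPoints_surjective_holds`, `card_torsionPoints_eq_sq_holds`).  At a REGULAR Kolyvagin prime `ℓ` for `p = 2` (`a_ℓ` even, `Δ` a non-square mod `ℓ`) `Frob_ℓ` is such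
  an `h` (it acts on `E[2] ∖ 0` as a transposition), for either sign of `Δ`.
* `localKummerLossless` — card #7's `LocalKummerLossless`: for ANY `ℤ/2^M`-linear endomorphism `σ` of `(ℤ/2^M)²` (`M ≥ 1`; the
  involution hypothesis `σ² = 1` of the card's statement is not needed and is dropped), `(1 + σ) x` has exact additive order `2^M` for
  some `x` iff `σ` moves some `2`-torsion vector.  (⇒) `v := 2^{M-1}•x`; (⇐) write `v = 2^{M-1}•w` and use
  `2^{M-1}•σw − 2^{M-1}•w = 2^{M-1}•(w + σw)`.  A DIAGONAL `σ ≡ 1 (mod 2)` therefore loses the top bit (residual 24883's wall); a regular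
  one does not.

Pure algebra; no curve input beyond the tree's torsion structure theorems.  BSD is not proved by this; the crux is not proved by this
(its seven registered stubs are untouched); nothing here is an instance of the crux or of a stub.

References: [SilvermanAEC2009] III.4.2(a), III.6.4(b); [GrossLMS1991] §4; [McCallumLMS1991] §5.
-/

set_option linter.dupNamespace false -- tree convention: `Summit.BirchSwinnertonDyer.BirchSwinnertonDyer.Theorems` (summit = sub-problem)
set_option autoImplicit false
noncomputable section

open scoped Classical

namespace Summit.BirchSwinnertonDyer.BirchSwinnertonDyer.Theorems.OffBigImageOddLocalAtTwo

open WeierstrassCurve Field Literature.NumberTheory.EllipticCurves Literature.NumberTheory.GaloisRepresentations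
  Summit.BirchSwinnertonDyer.BirchSwinnertonDyer.Theorems.GenusCyclicTorsion

/-! ## R1: `E[2^M]` is cyclic over `ℤ[h]` for every `h ∈ Γ_ℚ` moving a `2`-torsion point -/

/-- **R1 (`CyclicTorsionOfRegularElement`).**  For every `h ∈ Gal(ℚ̄/ℚ)` moving some `v ∈ E[2]` and every `M`, some `P ∈ E[2^M]` has
`E[2^M] = {a·P + b·hP : a, b ∈ ℤ}` (so `E[2^M] ≅ ℤ/2^M[⟨h⟩]` free of rank one).  Proof = `GenusCyclicTorsion.cyclicTorsionOfNegDisc_proof`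
with the moved `2`-torsion point as hypothesis: lift `v` to `P` with `2^k P = v` (`zsmul_geomPoints_surjective_holds`), independence of
`P, hP` modulo `2^{k+1}` (`pow_dvd_of_rel`), and counting against `#E[2^{k+1}] = 4^{k+1}` (`card_torsionPoints_eq_sq_holds`).
[cite: SilvermanAEC2009, Cor. III.6.4(b) and Prop. III.4.2(a)] [cite: McCallumLMS1991, §5] -/
theorem cyclicTorsion_of_smul_twoTorsion_ne (W : WeierstrassCurve ℚ) [W.IsElliptic] (c₀ : Field.absoluteGaloisGroup ℚ) (M : ℕ)
    (hmv : ∃ v : W.geomTorsion 2, c₀ • v ≠ v) :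
    ∃ P : W.geomTorsion ((2 ^ M : ℕ) : ℤ), ∀ Q : W.geomTorsion ((2 ^ M : ℕ) : ℤ), ∃ a b : ℤ, Q = a • P + b • (c₀ • P) := by
  cases M with
  | zero =>
    refine ⟨0, fun Q ↦ ⟨0, 0, ?_⟩⟩
    obtain ⟨Q₀, hQ₀⟩ := Q
    have h : ((2 ^ 0 : ℕ) : ℤ) • Q₀ = 0 := (mem_geomTorsion_iff W _ Q₀).mp hQ₀
    rw [pow_zero, Nat.cast_one, one_zsmul] at h
    subst h
    apply Subtype.ext
    simp
  | succ k =>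
    -- a `2`-torsion point moved by `c₀` (the hypothesis)
    obtain ⟨v, hv⟩ := hmv
    have hv2 : (2 : ℤ) • (v : geomPoints W) = 0 := (mem_geomTorsion_iff W 2 (v : geomPoints W)).mp v.2
    have hcv : c₀ • (v : geomPoints W) ≠ v := fun h ↦ hv (Subtype.ext h)
    -- lift it: `2^k · P₀ = v`, so `P₀ ∈ E[2^(k+1)]`
    obtain ⟨P₀, hP₀⟩ := W.zsmul_geomPoints_surjective_holds (n := ((2 ^ k : ℕ) : ℤ))
      (by exact_mod_cast pow_ne_zero k two_ne_zero) (v : geomPoints W)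
    simp only at hP₀
    set N : ℕ := 2 ^ (k + 1) with hN
    have hN2 : ((N : ℕ) : ℤ) = 2 * ((2 ^ k : ℕ) : ℤ) := by rw [hN]; push_cast; ring
    have hmem : ∀ {Q : geomPoints W}, ((2 ^ k : ℕ) : ℤ) • Q = v ∨ ((2 ^ k : ℕ) : ℤ) • Q = c₀ • (v : geomPoints W) →
        Q ∈ geomTorsion W (N : ℤ) := by
      intro Q hQ
      rw [mem_geomTorsion_iff, hN2, mul_zsmul]
      rcases hQ with h | h
      · rw [h, hv2]
      · rw [h, ← smul_zsmul_geomPoints, hv2, smul_zero]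
    have hP₀mem : P₀ ∈ geomTorsion W (N : ℤ) := hmem (Or.inl hP₀)
    have hcP₀ : ((2 ^ k : ℕ) : ℤ) • (c₀ • P₀) = c₀ • (v : geomPoints W) := by
      rw [← smul_zsmul_geomPoints, hP₀]
    refine ⟨⟨P₀, hP₀mem⟩, ?_⟩
    -- the counting map
    haveI : NeZero N := ⟨pow_ne_zero _ two_ne_zero⟩
    have hlin : ∀ a b : ℤ, a • P₀ + b • (c₀ • P₀) ∈ geomTorsion W (N : ℤ) := fun a b ↦
      add_mem (AddSubgroup.zsmul_mem _ hP₀mem a) (AddSubgroup.zsmul_mem _ (hmem (Or.inr hcP₀)) b)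
    let g : ZMod N × ZMod N → geomTorsion W (N : ℤ) := fun ab ↦
      ⟨(ab.1.val : ℤ) • P₀ + (ab.2.val : ℤ) • (c₀ • P₀), hlin _ _⟩
    have hinj : Function.Injective g := by
      rintro ⟨a, b⟩ ⟨a', b'⟩ h
      have h' : ((a.val : ℤ) - a'.val) • P₀ + ((b.val : ℤ) - b'.val) • (c₀ • P₀) = 0 := by
        have h0 := congrArg (fun Q : geomTorsion W (N : ℤ) ↦ (Q : geomPoints W)) h
        simp only [g] at h0
        rw [sub_zsmul, sub_zsmul, ← sub_eq_zero.mpr h0]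
        abel
      obtain ⟨ha, hb⟩ := pow_dvd_of_rel c₀ hv2 hcv k P₀ hP₀ _ _ h'
      have hmod : ∀ {x y : ZMod N}, ((N : ℕ) : ℤ) ∣ (x.val : ℤ) - y.val → x = y := by
        intro x y hxy
        apply ZMod.val_injective N
        exact ((Nat.modEq_iff_dvd.mpr hxy).eq_of_lt_of_lt (ZMod.val_lt y) (ZMod.val_lt x)).symm
      exact Prod.ext (hmod ha) (hmod hb)
    have hcardT : Nat.card (geomTorsion W (N : ℤ)) = N ^ 2 :=
      card_torsionPoints_eq_sq_holds W (AlgebraicClosure ℚ) (n := N) (by exact_mod_cast (NeZero.ne N))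
    haveI : Finite (geomTorsion W (N : ℤ)) := Nat.finite_of_card_ne_zero (by rw [hcardT]; positivity)
    have hle : Nat.card (geomTorsion W (N : ℤ)) ≤ Nat.card (ZMod N × ZMod N) := by
      rw [hcardT, Nat.card_prod, Nat.card_zmod, sq]
    have hbij : Function.Bijective g := hinj.bijective_of_nat_card_le hle
    intro Q
    obtain ⟨⟨a, b⟩, hab⟩ := hbij.2 Q
    refine ⟨(a.val : ℤ), (b.val : ℤ), ?_⟩
    apply Subtype.ext
    rw [← hab]
    simp only [g, AddSubgroup.coe_add, AddSubgroupClass.coe_zsmul]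
    rfl

/-! ## `LocalKummerLossless`: `(1 + σ)` keeps an element of exact order `2^M` iff `σ` moves a `2`-torsion vector -/

/-- In `ZMod (2^(n+1))`: `2 * a = 0` iff `a` is a multiple of `2^n`. [folklore] -/
theorem two_mul_eq_zero_iff_zmod_pow (n : ℕ) (a : ZMod (2 ^ (n + 1))) :
    2 * a = 0 ↔ ∃ b : ZMod (2 ^ (n + 1)), a = 2 ^ n * b := by
  constructor
  · intro h
    have h1 : ((2 * a.val : ℕ) : ZMod (2 ^ (n + 1))) = 0 := by
      push_cast; rw [ZMod.natCast_zmod_val]; exact h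
    rw [ZMod.natCast_eq_zero_iff] at h1
    have h2 : 2 ^ n ∣ a.val := by
      obtain ⟨k, hk⟩ := h1
      refine ⟨k, ?_⟩
      have : 2 * a.val = 2 * (2 ^ n * k) := by rw [hk]; ring
      omega
    obtain ⟨b, hb⟩ := h2
    refine ⟨(b : ZMod (2 ^ (n + 1))), ?_⟩
    calc a = ((a.val : ℕ) : ZMod (2 ^ (n + 1))) := (ZMod.natCast_zmod_val a).symm
      _ = ((2 ^ n * b : ℕ) : ZMod (2 ^ (n + 1))) := by rw [hb]
      _ = 2 ^ n * (b : ZMod (2 ^ (n + 1))) := by push_cast; ring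
  · rintro ⟨b, rfl⟩
    calc (2 : ZMod (2 ^ (n + 1))) * (2 ^ n * b) = ((2 ^ (n + 1) : ℕ) : ZMod (2 ^ (n + 1))) * b := by
          push_cast; ring
      _ = 0 := by rw [ZMod.natCast_self]; simp

/-- The top power kills everything: `2^(n+1) • z = 0` on `(ℤ/2^(n+1))²`. [folklore] -/
theorem pow_succ_nsmul_eq_zero_zmod_pow (n : ℕ) (z : Fin 2 → ZMod (2 ^ (n + 1))) : 2 ^ (n + 1) • z = 0 := by
  rw [← Nat.cast_smul_eq_nsmul (ZMod (2 ^ (n + 1))), ZMod.natCast_self, zero_smul]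

/-- `2 • (2^n • z) = 0` on `(ℤ/2^(n+1))²`. [folklore] -/
theorem two_smul_pow_nsmul_eq_zero_zmod_pow (n : ℕ) (z : Fin 2 → ZMod (2 ^ (n + 1))) :
    (2 : ZMod (2 ^ (n + 1))) • (2 ^ n • z) = 0 := by
  rw [← Nat.cast_smul_eq_nsmul (ZMod (2 ^ (n + 1))) (2 ^ n) z, smul_smul]
  have : (2 : ZMod (2 ^ (n + 1))) * ((2 ^ n : ℕ) : ZMod (2 ^ (n + 1))) = 0 := by
    have h : (2 : ZMod (2 ^ (n + 1))) * ((2 ^ n : ℕ) : ZMod (2 ^ (n + 1))) =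
        ((2 ^ (n + 1) : ℕ) : ZMod (2 ^ (n + 1))) := by push_cast; ring
    rw [h, ZMod.natCast_self]
  rw [this, zero_smul]

/-- Exact additive order `2^(n+1)` on `(ℤ/2^(n+1))²` iff the `2^n`-multiple is non-zero. [folklore] -/
theorem addOrderOf_eq_pow_succ_iff_zmod_pow (n : ℕ) (z : Fin 2 → ZMod (2 ^ (n + 1))) :
    addOrderOf z = 2 ^ (n + 1) ↔ 2 ^ n • z ≠ 0 := by
  constructor
  · intro h hz
    have hdvd : addOrderOf z ∣ 2 ^ n := addOrderOf_dvd_of_nsmul_eq_zero hz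
    rw [h] at hdvd
    have := (Nat.pow_dvd_pow_iff_le_right (by norm_num : 1 < 2)).mp hdvd
    omega
  · intro hz
    exact addOrderOf_eq_prime_pow hz (pow_succ_nsmul_eq_zero_zmod_pow n z)

/-- Every `2`-torsion vector of `(ℤ/2^(n+1))²` is a `2^n`-multiple. [folklore] -/
theorem exists_pow_nsmul_eq_of_two_smul_eq_zero (n : ℕ) (v : Fin 2 → ZMod (2 ^ (n + 1)))
    (hv : (2 : ZMod (2 ^ (n + 1))) • v = 0) : ∃ w : Fin 2 → ZMod (2 ^ (n + 1)), 2 ^ n • w = v := by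
  have hc : ∀ i, ∃ b : ZMod (2 ^ (n + 1)), v i = 2 ^ n * b := fun i =>
    (two_mul_eq_zero_iff_zmod_pow n (v i)).mp (by simpa using congr_fun hv i)
  choose w hw using hc
  refine ⟨w, funext fun i => ?_⟩
  rw [Pi.smul_apply, ← Nat.cast_smul_eq_nsmul (ZMod (2 ^ (n + 1))), smul_eq_mul, hw i]
  push_cast; ring

/-- **`LocalKummerLossless`** (card #7; the skeleton's statement with the unused involution binder `σ * σ = 1` dropped): for `M ≥ 1` and any
`ℤ/2^M`-linear `σ` on `(ℤ/2^M)²`, `(1 + σ) x` has exact order `2^M` for some `x` iff `σ` moves some `2`-torsion vector.  Key identity (with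
`M = n + 1`): `2^n • σ w − 2^n • w = 2^n • (w + σ w)`, since `2 • 2^n • w = 0`. [folklore] -/
theorem localKummerLossless (M : ℕ) (hM : 1 ≤ M) (σ : (Fin 2 → ZMod (2 ^ M)) →ₗ[ZMod (2 ^ M)] (Fin 2 → ZMod (2 ^ M))) :
    (∃ x : Fin 2 → ZMod (2 ^ M), addOrderOf ((1 + σ) x) = 2 ^ M) ↔
      ∃ v : Fin 2 → ZMod (2 ^ M), (2 : ZMod (2 ^ M)) • v = 0 ∧ σ v ≠ v := by
  obtain ⟨n, rfl⟩ : ∃ n, M = n + 1 := ⟨M - 1, by omega⟩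
  have h1σ : ∀ x : Fin 2 → ZMod (2 ^ (n + 1)), (1 + σ) x = x + σ x := fun x => by
    simp [LinearMap.add_apply]
  have hcomm : ∀ w : Fin 2 → ZMod (2 ^ (n + 1)), σ (2 ^ n • w) = 2 ^ n • σ w := fun w => map_nsmul σ _ _
  have hkey : ∀ w : Fin 2 → ZMod (2 ^ (n + 1)), 2 ^ n • σ w - 2 ^ n • w = 2 ^ n • (w + σ w) := by
    intro w
    have h2 : (2 : ZMod (2 ^ (n + 1))) • (2 ^ n • w) = 0 := two_smul_pow_nsmul_eq_zero_zmod_pow n w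
    have h2' : (2 ^ n • w) + (2 ^ n • w) = 0 := by rw [← two_smul (ZMod (2 ^ (n + 1))), h2]
    rw [smul_add, sub_eq_iff_eq_add]
    have : 2 ^ n • w + 2 ^ n • σ w + 2 ^ n • w = 2 ^ n • σ w + (2 ^ n • w + 2 ^ n • w) := by abel
    rw [this, h2', add_zero]
  constructor
  · rintro ⟨x, hx⟩
    rw [h1σ, addOrderOf_eq_pow_succ_iff_zmod_pow] at hx
    refine ⟨2 ^ n • x, two_smul_pow_nsmul_eq_zero_zmod_pow n x, ?_⟩
    intro hfix
    rw [hcomm] at hfix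
    apply hx
    rw [← hkey, hfix, sub_self]
  · rintro ⟨v, hv2, hvσ⟩
    obtain ⟨w, rfl⟩ := exists_pow_nsmul_eq_of_two_smul_eq_zero n v hv2
    refine ⟨w, ?_⟩
    rw [h1σ, addOrderOf_eq_pow_succ_iff_zmod_pow, ← hkey]
    intro h0
    apply hvσ
    rw [hcomm]
    exact sub_eq_zero.mp h0

end Summit.BirchSwinnertonDyer.BirchSwinnertonDyer.Theorems.OffBigImageOddLocalAtTwo

end
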